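import Literature.NumberTheory.GaloisRepresentations.TateSpinLiftContinuousProofs
import Literature.NumberTheory.GaloisRepresentations.ProjectiveLiftingProofs
import HarnessLib

/-!
# Spin lifts through `D₃ = A₃`: the Proposition for `GSpin₆ ↠ SO₆` from Tate's theorem
# `H²(Γ_F, ℚ/ℤ) = 0` alone

Second sibling proof file of `TateSpinLiftContinuousProofs.lean`.  The printed proof (S. Patrikis,
*Variations on a theorem of Tate*, Mem. AMS 258 (2019), no. 1238, Ch. 2 §2.1, the Proposition
= arXiv:1207.6724 Prop. 1.0.18 = B. Conrad, *Lifting global representations with local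
properties*, Prop. 5.3, for `GSpin₆ ↠ SO₆`) has exactly ONE arithmetic input, Tate's theorem
`H²(Γ_F, ℚ/ℤ) = 0` (Patrikis Thm. 1.0.16 = Serre, Durham survey, Thm. 4: "`lim→ H²(Γ_F, ℤ/n) =
H²(Γ_F, ℚ/ℤ)`, and by Tate's theorem this group is zero"); the rest is

* the obstruction-theoretic layer for `GL₄ ↠ PGL₄` (continuous set-theoretic lift, `μ_n`-valued
  obstruction cocycle, twist by a splitting cochain), PROVED in `ProjectiveLiftingProofs.lean`
  with Tate's theorem as a hypothesis in locally-constant-cochain form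
  (`Patrikis2019_exists_lift_of_H2_addCircle`), and
* the `D₃ = A₃` transfer `GSpin₆ ↠ SO₆` ⇝ `GL₄ ↠ PGL₄`, PROVED in
  `TateSpinLiftContinuousProofs.lean` (`exists_projective_spinDatum`).

`TateSpinLiftContinuousProofs.lean` records the reduction of the spin-lift statement to the NAMED
FACT `Patrikis2019_exists_lift_projective` (parts (i) and (ii)); this file composes the two
proved layers directly and records the sharper dependency on Tate's theorem alone:

* `exists_spinLift_of_H2_addCircle` — for ONE number field `F`: if every locally constant
  `ℚ/ℤ`-valued `2`-cocycle on `Γ_F` is the coboundary of a locally constant cochain, then every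
  continuous `r : Γ_F → GL₆(ℚ̄_ℓ)` preserving a non-degenerate symmetric form with `det r = 1` has
  a continuous `W : Γ_F → GL₄(ℚ̄_ℓ)` and a continuous `ν` with `ν · tr r = tr ∧²W`;
* `Patrikis2019_exists_spinLift_of_continuous_of_H2_addCircle` — Tate's theorem for all number
  fields (cochain form) ⇒ the Proposition for `GSpin₆ ↠ SO₆` over every number field, stated
  EXPLICITLY (all quantifiers written out).

The statement used to be packaged as a separate named fact
`Patrikis2019_exists_spinLift_of_continuous` (`TateSpinLiftContinuous.lean`, vendored 2026-08-15
to ground an item of the since-retired route `Langlands/K3KugaSatakeDescent`).  Since it is a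
PROVED consequence of the named fact `Patrikis2019_exists_lift_projective`
(`Patrikis2019_exists_spinLift_of_continuous_of_lift_projective`,
`TateSpinLiftContinuousProofs.lean`) — itself proved EQUIVALENT to Tate's theorem in cochain form
(`Patrikis2019_exists_lift_projective_iff_H2_addCircle`, `TateH2ReductionProofs.lean`) — the
separate fact is being merged back into that one (D-0026/D-0027 review, 2026-08-15): the theorems
of this file no longer mention it and carry the statement verbatim instead.

In particular part (ii) of the projective fact (the almost everywhere unramified refinement,
Conrad Lemma 5.2) is NOT needed for the ramification-free spin-lift statement.  NOT a discharge of
anything: Tate's theorem is global class field theory (local–global structure of the Brauer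
group); in this tree it is reduced to the Poitou–Tate fact
`Literature.NumberTheory.GaloisCohomology.poitouTate_sha_zmod_mu` plus the vanishing of
`Ш¹(K, μ_m)` (`TateH2VanishingGlobalAssembly.lean`, `PoitouTateSha.lean`), proved so far only over
`ℚ` (`ShaOneMuRat.lean`).

## References

* [Patrikis2019] S. Patrikis, *Variations on a theorem of Tate*, Mem. Amer. Math. Soc. 258
  (2019), no. 1238, Ch. 2 §2.1: Tate's theorem and the Proposition (lifting through central
  torus quotients) (= arXiv:1207.6724 Thm. 1.0.16, Prop. 1.0.18; held text pp. 14–15).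
* B. Conrad, *Lifting global representations with local properties*, preprint (2011), Prop. 5.3.
* J.-P. Serre, *Modular forms of weight one and Galois representations*, in: Algebraic Number
  Fields (Durham 1975), Academic Press 1977, §6.5, Thm. 4 (Tate).
-/

noncomputable section

namespace Literature.NumberTheory.GaloisRepresentations

open Field SpinLift
open scoped Matrix

variable {F : Type} [Field F] [NumberField F] {ℓ : ℕ} [Fact ℓ.Prime]

/-- **The Proposition for `GSpin₆ ↠ SO₆` over a fixed number field `F`, from Tate's theorem
`H²(Γ_F, ℚ/ℤ) = 0` in locally-constant-cochain form.**  If every locally constant `2`-cocycle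
`f : Γ_F × Γ_F → ℚ/ℤ` is the coboundary of a locally constant `b : Γ_F → ℚ/ℤ` (Patrikis
Thm. 1.0.16 = Serre, Durham survey, Thm. 4 — the single class-field-theoretic input of the
printed proof, NOT in the tree, hence a hypothesis), then every continuous
`r : Γ_F → GL₆(ℚ̄_ℓ)` preserving a non-degenerate symmetric bilinear form `J` with `det r = 1`
admits a continuous `W : Γ_F → GL₄(ℚ̄_ℓ)` and a continuous character `ν` with
`ν(σ) · tr r(σ) = ((tr W(σ))² − tr W(σ²)) / 2` (`∧²W ≅ ν ⊗ r` in trace form).  Proof = the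
printed one: conjugate `r` into `SO(Q₀)`, pass to the projective representation
`φ : Γ_F → PGL₄(ℚ̄_ℓ)` through `D₃ = A₃` (`exists_projective_spinDatum`), lift `φ` by the
obstruction-theoretic layer plus Tate's theorem (`Patrikis2019_exists_lift_of_H2_addCircle`),
and read off `ν`.
[cite: Patrikis2019, Ch. 2 §2.1, Tate's theorem and the Proposition (= arXiv:1207.6724 Thm. 1.0.16, Prop. 1.0.18 = Conrad Prop. 5.3)] -/
theorem exists_spinLift_of_H2_addCircle
    (hTate : ∀ f : absoluteGaloisGroup F → absoluteGaloisGroup F → AddCircle (1 : ℚ),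
      IsLocallyConstant (Function.uncurry f) →
      (∀ σ τ υ, f σ τ + f (σ * τ) υ = f τ υ + f σ (τ * υ)) →
      ∃ b : absoluteGaloisGroup F → AddCircle (1 : ℚ), IsLocallyConstant b ∧
        ∀ σ τ, f σ τ + b (σ * τ) = b σ + b τ)
    (r : FramedGaloisRep F (PadicAlgCl ℓ) 6)
    (hJ : ∃ J : Matrix (Fin 6) (Fin 6) (PadicAlgCl ℓ), J.IsSymm ∧ IsUnit J ∧
      ∀ σ, ((r σ : GL (Fin 6) (PadicAlgCl ℓ)) : Matrix (Fin 6) (Fin 6) (PadicAlgCl ℓ))ᵀ * J *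
        ((r σ : GL (Fin 6) (PadicAlgCl ℓ)) : Matrix (Fin 6) (Fin 6) (PadicAlgCl ℓ)) = J)
    (hdet : ∀ σ, FramedRep.det r σ = 1) :
    ∃ (W : FramedGaloisRep F (PadicAlgCl ℓ) 4) (ν : absoluteGaloisGroup F →ₜ* (PadicAlgCl ℓ)ˣ),
      ∀ σ, (ν σ : PadicAlgCl ℓ) * FramedRep.trace r σ =
          (FramedRep.trace W σ ^ 2 - FramedRep.trace W (σ * σ)) / 2 := by
  obtain ⟨φ, -, hφ⟩ := exists_projective_spinDatum r hJ hdet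
  obtain ⟨W, hW⟩ := Patrikis2019_exists_lift_of_H2_addCircle F ℓ 4 hTate φ
  exact ⟨W, hφ W hW⟩

/-- **Tate's theorem `H²(Γ_F, ℚ/ℤ) = 0` (every number field `F`, cochain form) ⇒ the
Proposition of Patrikis 2019, Ch. 2 §2.1 (= Conrad Prop. 5.3) for `GSpin₆ ↠ SO₆` over every
number field**: for a number field `F`, a prime `ℓ` and a continuous `r : Γ_F → GL₆(ℚ̄_ℓ)`
preserving a non-degenerate symmetric bilinear form `J` with `det r = 1`, there are a continuous
`W : Γ_F → GL₄(ℚ̄_ℓ)` and a continuous character `ν` with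
`ν(σ) · tr r(σ) = ((tr W(σ))² − tr W(σ²)) / 2` for all `σ`.  The whole printed proof modulo its
single class-field-theoretic input (Patrikis Thm. 1.0.16 = Serre, Durham survey, Thm. 4), which
is not proved in the tree; the conclusion is written out explicitly (formerly the named fact
`Patrikis2019_exists_spinLift_of_continuous`, merged into `Patrikis2019_exists_lift_projective`:
compare `Patrikis2019_exists_spinLift_of_continuous_of_lift_projective`,
`TateSpinLiftContinuousProofs.lean`, the reduction to that NAMED FACT for `GL₄ ↠ PGL₄`, whose
part (i) is Tate's theorem plus `ProjectiveLiftingProofs.lean` and whose part (ii), Conrad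
Lemma 5.2, is not needed here).
[cite: Patrikis2019, Ch. 2 §2.1, Tate's theorem and the Proposition (= arXiv:1207.6724 Thm. 1.0.16, Prop. 1.0.18 = Conrad Prop. 5.3)] -/
theorem Patrikis2019_exists_spinLift_of_continuous_of_H2_addCircle
    (hTate : ∀ (F : Type) [Field F] [NumberField F]
      (f : absoluteGaloisGroup F → absoluteGaloisGroup F → AddCircle (1 : ℚ)),
      IsLocallyConstant (Function.uncurry f) →
      (∀ σ τ υ, f σ τ + f (σ * τ) υ = f τ υ + f σ (τ * υ)) →
      ∃ b : absoluteGaloisGroup F → AddCircle (1 : ℚ), IsLocallyConstant b ∧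
        ∀ σ τ, f σ τ + b (σ * τ) = b σ + b τ)
    (F : Type) [Field F] [NumberField F] (ℓ : ℕ) [Fact ℓ.Prime]
    (r : FramedGaloisRep F (PadicAlgCl ℓ) 6)
    (hJ : ∃ J : Matrix (Fin 6) (Fin 6) (PadicAlgCl ℓ), J.IsSymm ∧ IsUnit J ∧
      ∀ σ, ((r σ : GL (Fin 6) (PadicAlgCl ℓ)) : Matrix (Fin 6) (Fin 6) (PadicAlgCl ℓ))ᵀ * J *
        ((r σ : GL (Fin 6) (PadicAlgCl ℓ)) : Matrix (Fin 6) (Fin 6) (PadicAlgCl ℓ)) = J)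
    (hdet : ∀ σ, FramedRep.det r σ = 1) :
    ∃ (W : FramedGaloisRep F (PadicAlgCl ℓ) 4) (ν : absoluteGaloisGroup F →ₜ* (PadicAlgCl ℓ)ˣ),
      ∀ σ, (ν σ : PadicAlgCl ℓ) * FramedRep.trace r σ =
          (FramedRep.trace W σ ^ 2 - FramedRep.trace W (σ * σ)) / 2 :=
  exists_spinLift_of_H2_addCircle (hTate F) r hJ hdet

end Literature.NumberTheory.GaloisRepresentations

end
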